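import Summits.HodgeConjecture.HodgeConjecture.Theorems.F0P6aPELWitnessE   -- ★ p850400 twin of ED. 5 4cba526fb67849a3 (part A ★ p850380 `…F0P6aPELWitnessEStubs` rides its import; namespace KEPT ⇒ every other FQN unchanged)
import HarnessLib

/-! # F0_P6a_PELWitnessE — ED. 6 = SHIM (rung-0 re-home; LEAD «M-72» (4) ∕ «M-78» CLASS III, «K3» sweep; dealer «L7» LA7-plan (g4∕g5); desk F0P6a-plan (g5) 09:18:55Z row 24)

Every declaration of the E-LINE ED. 5 (sha16 4cba526fb67849a3, 519 l., sorry-free: `stub_SIG`, `conjTranspose_map_id_of_transpose_map_complexConj`, `stub_E123`, `stub_E4`,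
`stub_E5`, `stub_E6`, `pelWitnessE_of_line`) now lives, byte for byte and under the SAME namespace `Summit.HodgeConjecture.HodgeConjecture.Cruxes.HLiu418.F0P6aPELWitnessE`,
in ★ `Theorems/F0P6aPELWitnessE.lean` (p850400) and its part A ★ `Theorems/F0P6aPELWitnessEStubs.lean` (p850380) (RE-HOME TABLE v1.3.1∕v1.3.2 row 24); this module keeps
its name so that its importers (`rg` 09:4xZ: `F0_P6a_StubKOTT`, `F0_P6a_PELInputs`) and by-name readers (`F0_P6a_EExports` :256–257, `stub_UNIVFAM` unqualified under
`open …F0P6aPELWitnessE`) resolve unchanged through the import above.  The ONE name the ★ twin does not restate — `stub_UNIVFAM`, CUT there under `dedup.landed`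
because the printed letter P-3 IS the theorem ★ p849986 `Literature.AlgebraicGeometry.ModuliOfAbelianVarieties.siegelUniversalFamilyUniformisation_holds` — is kept alive
here BY NAME with its ED. 5 statement byte-identical, `:=` the ★ payer (LA7-plan (g4) 09:08:15Z (a), LA6-r01 #26 fix (a); the ED. 5 proof term
`…StubUNIVFAM.stub_UNIVFAM_closed` lives in a Lines leaf over the declaring (D) module and cannot be co-imported with the ★ (D) twin).  ORDER NOTE: written together
with ∕ after the row-20 (`F0_P6a_PELWitnessEDefs`), row-21 (`F0_P6a_SigmaGAL`) and row-22 (`F0_P6a_StubE6`) shims — the ★ twin reaches ★ (D) through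
★ `F0P6aPELWitnessEStubs → F0P6aPELWitnessEDefs` and ★ E6, while the importers still reach the Lines (D) through `Lines.F0_P6a_RGDAssembly ∕ F0_P6a_PELInputs` until row 20
lands (one «K3» request, lake orders).  Edition history ED. 1–5 stays in the line card and in git; future changes are ★-side proposals on the `Theorems/` files.  HC_CM is
proved only modulo the 7 printed citations (2 remaining named inputs hLiu418 = stmt-HodgeConjecture-24832, h413 = stmt-HodgeConjecture-24833) until rung 0 closes;
count-neutral (0 `sorry`, 0 socket; the one theorem below is an alias by proof term). -/

noncomputable section

set_option autoImplicit false
set_option linter.dupNamespace false  -- `Summit.HodgeConjecture.HodgeConjecture.…` BY DESIGN (D-0017)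

namespace Summit.HodgeConjecture.HodgeConjecture.Cruxes.HLiu418.F0P6aPELWitnessE

/-- **`stub_UNIVFAM` — THE PRINTED LETTER P-3 «UNIV-FAMILY»** — **CLOSED BY NAME in ED. 5 (LEAD «M-64» (3)(4)) by the L7 closer leaf
`Lines/F0_P6a_StubUNIVFAM.lean` (`…Cruxes.HLiu418.StubUNIVFAM.stub_UNIVFAM_closed`, LA7-plan (g0), imports the Defs layer only): organs ADM-NF ★ p847727,
ALIGN ★ p847835, MATCH ★ p847965, GLUE ★ p847935, FLAT ★ p847957∕p848159∕p848424∕p848162∕p848386 all PAID; its ONE printed residue is `stub_RELEXP` =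
★ P-1 `relativeExponentialUniformisation` ([DeligneHodgeII1971] (4.4.2)) BY NAME — so the E-line՚s printed door for the universal family is paid down from the
composite letter P-3 to the one sentence P-1 (printed-citation count unchanged); registered name and statement kept** (★ named fact `siegelUniversalFamilyUniformisation`, p847075; the analytic uniformisation of the
UNIVERSAL FAMILY over the Siegel pieces — relative exponential charts with period family `Π_{s̃ t}` along holomorphic lifts, admissible markings of the fibres;
[Lange2023AbelianVarietiesComplex] §3.4, [BirkenhakeLange2004] §8.7–§8.8, [MumfordFogartyKirwan1994] App. 7A).  Consumed IN-LINE by `stub_E6`՚s closer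
(E6 owner A-p06 (g32), skeleton v0 c3f38614 socket `stub_UNIVFAM` by value); §8.4 pricing of record: printed input of the MOD cone, booked at this edition.
[cite: Lange2023AbelianVarietiesComplex, Prop. 3.4.1 p. 186, Lemma 3.4.7 and Prop. 3.4.8 pp. 189–191 + Ex. 3.4.5 (7) p. 191 (universality)]
[cite: BirkenhakeLange2004, §8.7–§8.8 pp. 229–234] [cite: MumfordFogartyKirwan1994, Appendix to Ch. 7 §A pp. 234–235] -/
theorem stub_UNIVFAM : Literature.AlgebraicGeometry.ModuliOfAbelianVarieties.siegelUniversalFamilyUniformisation :=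
  -- ED. 6: PAID BY NAME (statement UNCHANGED) — ★ p849986 `Literature/AlgebraicGeometry/ModuliOfAbelianVarieties/SiegelUniversalFamilyUniformisationHolds` (LA7-p02 (g3)).
  Literature.AlgebraicGeometry.ModuliOfAbelianVarieties.siegelUniversalFamilyUniformisation_holds

end Summit.HodgeConjecture.HodgeConjecture.Cruxes.HLiu418.F0P6aPELWitnessE

end
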